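import Summits.AtomisticToContinuum.HydrodynamicLimit.Theorems.InformationPercolationEngineCollisionRateUnitMarkTruncationRung0
import Summits.AtomisticToContinuum.HydrodynamicLimit.Theorems.JParityClosureEvenStressEnskogKineticEnergyTight
import Summits.AtomisticToContinuum.HydrodynamicLimit.Theses.InformationPercolationEngine
import Literature.MathematicalPhysics.KineticTheory.CollisionSumMarkComparison
import HarnessLib

/-!
# T1 · unit-mark velocity truncation under the EVOLVED local Gibbs law (`stub_unitMarkTruncation`, line `Sketch`
# v17, crux `InformationPercolationEngine.CollisionRate`, stmt-AtomisticToContinuum-13481)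

Registered stub T1 (skeleton v17, lead c2; proved by the parallel seat c3): GIVEN the route's tail support
`CollisionMomentBound` (stmt-15144, an antecedent), for GENERAL continuous positive profiles — a local Gibbs law that
is NOT invariant under the flow — replacing the unit mark by `Ξ₁ᴸ = ψ_L(‖w − v‖)` changes `evenStat` by more than `η`
only on an event of probability `≤ δ` (`L ≥ L₀(r, …)`, `N ≥ N₀`).  No statics and no entropy are needed at the unit
mark: both truncation errors carry a factor `1/L` against conserved or tight quantities.  ENSKOG SIDE:
`Θ 1 − Θ Ξ₁ᴸ = π‖w − v‖(1 − ψ_L) ≤ π‖w − v‖²/L ≤ 2π(‖v‖² + ‖w‖²)/L`, so `|∫₀^τ e(1) − ∫₀^τ e(Ξ₁ᴸ)| ≤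
C_χ C_{gY}(3/πr³)² 8π τ E(z)/((N+1)L)` along a good orbit (`E` conserved, `HardSphereFlow.configEnergy_flow`), and the
kinetic energy per particle is tight (`Theorems.EvenStressEnskog.stub_kineticEnergyTight`).  COLLISION SIDE:
`|K_N[χ g 1] − K_N[χ g Ξ₁ᴸ]| ≤ C_χ K_N[1·|g|·m_L]` (`abs_collisionSum_one_sub_le`) and at a collision
`m_L(n, v⁻, w⁻) ≤ ‖w⁻ − v⁻‖²/L ≤ 2(‖v‖² + ‖w‖²)/L` (elastic reflection conserves the pair energy), whence
`K_N[1·|g|·m_L] ≤ (2C_g/L) K_N[1 + ‖vᵢ‖² + ‖vⱼ‖²]` — the functional of `CollisionMomentBound`.  So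
`{η < |D(1) − D(Ξ₁ᴸ)|} ⊆ goodᶜ ∪ {K < (N+1)⁻¹E} ∪ {K_b < K_N[1 + ‖vᵢ‖² + ‖vⱼ‖²]}` for
`L ≥ max(1, 4C_χC_gK_b/η, 2σ³τC_EK/η)`, each tightness input at `δ/2`.

References: H. Spohn, *Large Scale Dynamics of Interacting Particles* (1991), Part I §2–3; C. Cercignani, R. Illner,
M. Pulvirenti (1994) §2.2, §4.2; Chapman–Cowling (1970) Ch. 16.
-/

noncomputable section

open MeasureTheory Set Filter Topology
open scoped ENNReal InnerProductSpace BigOperators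

namespace Summit.AtomisticToContinuum.HydrodynamicLimit.Theorems.CollisionRate

open Literature.Analysis.FluidPDE Literature.MathematicalPhysics.KineticTheory
open Summit.AtomisticToContinuum.HydrodynamicLimit.Theses.InformationPercolationEngine (CollisionMomentBound)
open Summit.AtomisticToContinuum.HydrodynamicLimit.Theorems.EvenStressEnskog
  (stub_kineticEnergyTight exists_bound_mul_contactValue)

/-! ## One configuration: the `1/L` truncation bounds at the unit mark -/

/-- `‖w − v‖(1 − ψ_L(‖w − v‖)) ≤ ‖w − v‖²/L` (`0 < L`): both sides vanish for `‖w − v‖ ≤ L`. [folklore] -/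
theorem norm_mul_one_sub_speedCutoff_le {L : ℝ} (hL : 0 < L) (v w : V3) :
    ‖w - v‖ * (1 - speedCutoff L ‖w - v‖) ≤ ‖w - v‖ ^ 2 / L := by
  have hψ := speedCutoff_mem_Icc L ‖w - v‖
  by_cases h : ‖w - v‖ ≤ L
  · rw [speedCutoff_eq_one hL h, sub_self, mul_zero]
    positivity
  · push Not at h
    have h1 : ‖w - v‖ * (1 - speedCutoff L ‖w - v‖) ≤ ‖w - v‖ * 1 :=
      mul_le_mul_of_nonneg_left (sub_le_self _ hψ.1) (norm_nonneg _)
    rw [mul_one] at h1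
    refine h1.trans ?_
    rw [le_div_iff₀ hL, sq]
    exact mul_le_mul_of_nonneg_left h.le (norm_nonneg _)

/-- `‖w − v‖² ≤ 2(‖v‖² + ‖w‖²)`. [folklore] -/
theorem norm_sub_sq_le_two_mul (v w : V3) : ‖w - v‖ ^ 2 ≤ 2 * (‖v‖ ^ 2 + ‖w‖ ^ 2) := by
  have h : ‖w - v‖ ≤ ‖w‖ + ‖v‖ := norm_sub_le w v
  nlinarith [norm_nonneg (w - v), norm_nonneg v, norm_nonneg w, sq_nonneg (‖v‖ - ‖w‖)]

/-- `|Θ 1 (v, w) − Θ Ξ₁ᴸ (v, w)| ≤ (2π/L)(‖v‖² + ‖w‖²)` for `1 ≤ L` (the difference is `π‖w − v‖(1 − ψ_L)` exactly,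
`sphereMark_const_one`, `sphereMark_speedCutoff`). [folklore] -/
theorem abs_sphereMark_one_sub_le_energy {L : ℝ} (hL : 1 ≤ L) (v w : V3) :
    |sphereMark (fun _ => (1 : ℝ)) v w
        - sphereMark (fun q : V3 × V3 × V3 => speedCutoff L ‖q.2.2 - q.2.1‖) v w|
      ≤ 2 * Real.pi / L * (‖v‖ ^ 2 + ‖w‖ ^ 2) := by
  have hL0 : 0 < L := one_pos.trans_le hL
  have hψ := speedCutoff_mem_Icc L ‖w - v‖
  have heq : sphereMark (fun _ => (1 : ℝ)) v w
      - sphereMark (fun q : V3 × V3 × V3 => speedCutoff L ‖q.2.2 - q.2.1‖) v w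
      = Real.pi * (‖w - v‖ * (1 - speedCutoff L ‖w - v‖)) := by
    rw [sphereMark_const_one, sphereMark_speedCutoff, lorentzLossRate_eq_pi_mul_norm, norm_sub_rev v w]
    ring
  rw [heq, abs_mul, abs_of_pos Real.pi_pos,
    abs_of_nonneg (mul_nonneg (norm_nonneg _) (sub_nonneg.2 hψ.2))]
  calc Real.pi * (‖w - v‖ * (1 - speedCutoff L ‖w - v‖)) ≤ Real.pi * (‖w - v‖ ^ 2 / L) :=
        mul_le_mul_of_nonneg_left (norm_mul_one_sub_speedCutoff_le hL0 v w) Real.pi_pos.le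
    _ ≤ Real.pi * (2 * (‖v‖ ^ 2 + ‖w‖ ^ 2) / L) :=
        mul_le_mul_of_nonneg_left (div_le_div_of_nonneg_right (norm_sub_sq_le_two_mul v w) hL0.le)
          Real.pi_pos.le
    _ = 2 * Real.pi / L * (‖v‖ ^ 2 + ‖w‖ ^ 2) := by ring

/-- `|B_r 1 (z, x) − B_r Ξ₁ᴸ (z, x)| ≤ (3/πr³)² (8π/L) E(z)/(N+1)` (`1 ≤ L`, `0 < r`). [folklore] -/
theorem abs_pairFunctional_one_sub_le_energy {N : ℕ} {L r : ℝ} (hL : 1 ≤ L) (hr : 0 < r)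
    (z : Config (N + 1) (Fin 3) T3) (x : UnitAddTorus (Fin 3)) :
    |pairFunctional r (fun _ => (1 : ℝ)) z x
        - pairFunctional r (fun q : V3 × V3 × V3 => speedCutoff L ‖q.2.2 - q.2.1‖) z x|
      ≤ (3 / (Real.pi * r ^ 3)) ^ 2 * (8 * Real.pi / L) * (configEnergy z / ((N + 1 : ℕ) : ℝ)) := by
  have hL0 : 0 < L := one_pos.trans_le hL
  have hM0 : 0 ≤ 3 / (Real.pi * r ^ 3) := by positivity
  have hn : (0 : ℝ) < ((N + 1 : ℕ) : ℝ) := by exact_mod_cast Nat.succ_pos N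
  rw [pairFunctional_eq_double_sum, pairFunctional_eq_double_sum, ← mul_sub, abs_mul,
    abs_of_nonneg (by positivity : (0 : ℝ) ≤ ((N + 1 : ℕ) : ℝ)⁻¹ * ((N + 1 : ℕ) : ℝ)⁻¹)]
  have hterm : ∀ i j : Fin (N + 1),
      |coneKernel r (z i).1 x * coneKernel r (z j).1 x * sphereMark (fun _ => (1 : ℝ)) (z i).2 (z j).2 -
        coneKernel r (z i).1 x * coneKernel r (z j).1 x *
          sphereMark (fun q : V3 × V3 × V3 => speedCutoff L ‖q.2.2 - q.2.1‖) (z i).2 (z j).2|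
      ≤ (3 / (Real.pi * r ^ 3)) ^ 2 * (2 * Real.pi / L) * (‖(z i).2‖ ^ 2 + ‖(z j).2‖ ^ 2) := by
    intro i j
    have hbi : 0 ≤ coneKernel r (z i).1 x ∧ coneKernel r (z i).1 x ≤ 3 / (Real.pi * r ^ 3) :=
      coneKernel_nonneg_le hr (z i).1 x
    have hbj : 0 ≤ coneKernel r (z j).1 x ∧ coneKernel r (z j).1 x ≤ 3 / (Real.pi * r ^ 3) :=
      coneKernel_nonneg_le hr (z j).1 x
    rw [← mul_sub, abs_mul, abs_of_nonneg (mul_nonneg hbi.1 hbj.1)]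
    calc _ ≤ (3 / (Real.pi * r ^ 3) * (3 / (Real.pi * r ^ 3))) *
            (2 * Real.pi / L * (‖(z i).2‖ ^ 2 + ‖(z j).2‖ ^ 2)) :=
          mul_le_mul (mul_le_mul hbi.2 hbj.2 hbj.1 hM0) (abs_sphereMark_one_sub_le_energy hL _ _)
            (abs_nonneg _) (mul_nonneg hM0 hM0)
      _ = _ := by ring
  have hsum := abs_sum_sum_sub_le_of_le hterm
  calc _ ≤ ((N + 1 : ℕ) : ℝ)⁻¹ * ((N + 1 : ℕ) : ℝ)⁻¹ * ((3 / (Real.pi * r ^ 3)) ^ 2 * (2 * Real.pi / L) *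
          (2 * ((N + 1 : ℕ) : ℝ) * ∑ i, ‖(z i).2‖ ^ 2)) := by
        refine mul_le_mul_of_nonneg_left ?_ (by positivity)
        simpa only [Fintype.card_fin] using hsum
    _ = (3 / (Real.pi * r ^ 3)) ^ 2 * (8 * Real.pi / L) * (configEnergy z / ((N + 1 : ℕ) : ℝ)) := by
        unfold configEnergy
        field_simp
        ring

/-- `|e_t(1)(z) − e_t(Ξ₁ᴸ)(z)| ≤ C_χ C_{gY} (3/πr³)² (8π/L) E(z)/(N+1)` (`1 ≤ L`, `|χ(t, ·)| ≤ C_χ`, `|g·Y| ≤ C_{gY}`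
on `[0, ∞)`, `σ ≥ 0`, `r > 0`). [folklore] -/
theorem abs_enskogRate_one_sub_le_energy {σ : ℝ} {N : ℕ} {χ : ℝ × UnitAddTorus (Fin 3) → ℝ} {g : ℝ → ℝ}
    (hχ : Continuous χ) (hg : Continuous g) {t Cχ CgY : ℝ} (hχb : ∀ x, |χ (t, x)| ≤ Cχ)
    (hgY : ∀ a, 0 ≤ a → |g a * contactValue a| ≤ CgY) (hσ : 0 ≤ σ) {r L : ℝ} (hr : 0 < r) (hL : 1 ≤ L)
    (z : Config (N + 1) (Fin 3) T3) :
    |enskogRate σ N χ g (fun _ => (1 : ℝ)) r t z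
        - enskogRate σ N χ g (fun q : V3 × V3 × V3 => speedCutoff L ‖q.2.2 - q.2.1‖) r t z|
      ≤ Cχ * CgY * ((3 / (Real.pi * r ^ 3)) ^ 2 * (8 * Real.pi / L)) *
          (configEnergy z / ((N + 1 : ℕ) : ℝ)) := by
  have hL0 : 0 < L := one_pos.trans_le hL
  have hCχ0 : 0 ≤ Cχ := (abs_nonneg _).trans (hχb (z 0).1)
  have hCgY0 : 0 ≤ CgY := (abs_nonneg _).trans (hgY 0 le_rfl)
  unfold enskogRate
  rw [← integral_sub
    (integrable_enskogIntegrand hχ hg hgY hσ hr (continuous_sphereMark_uncurry continuous_const).measurable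
      abs_sphereMark_one_le' t z)
    (integrable_enskogIntegrand hχ hg hgY hσ hr
      (continuous_sphereMark_uncurry (continuous_speedCutoff_mark L)).measurable
      (abs_sphereMark_speedCutoff_le' hL0) t z)]
  have hb : ∀ x : UnitAddTorus (Fin 3),
      ‖χ (t, x) * g (σ ^ 3 * mollDensity r z x) * contactValue (σ ^ 3 * mollDensity r z x) *
          pairFunctional r (fun _ => (1 : ℝ)) z x -
        χ (t, x) * g (σ ^ 3 * mollDensity r z x) * contactValue (σ ^ 3 * mollDensity r z x) *
          pairFunctional r (fun q : V3 × V3 × V3 => speedCutoff L ‖q.2.2 - q.2.1‖) z x‖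
      ≤ Cχ * CgY * ((3 / (Real.pi * r ^ 3)) ^ 2 * (8 * Real.pi / L)) *
          (configEnergy z / ((N + 1 : ℕ) : ℝ)) := by
    intro x
    have ha : 0 ≤ σ ^ 3 * mollDensity r z x :=
      mul_nonneg (pow_nonneg hσ 3) (mollDensity_nonneg_of_pos hr z x)
    rw [← mul_sub, Real.norm_eq_abs, show χ (t, x) * g (σ ^ 3 * mollDensity r z x) *
      contactValue (σ ^ 3 * mollDensity r z x) = χ (t, x) * (g (σ ^ 3 * mollDensity r z x) *
        contactValue (σ ^ 3 * mollDensity r z x)) by ring, abs_mul, abs_mul, mul_assoc (Cχ * CgY)]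
    exact mul_le_mul (mul_le_mul (hχb x) (hgY _ ha) (abs_nonneg _) hCχ0)
      (abs_pairFunctional_one_sub_le_energy hL hr z x) (abs_nonneg _) (mul_nonneg hCχ0 hCgY0)
  have h := norm_integral_le_of_norm_le_const (μ := volume) (ae_of_all _ hb)
  rwa [Real.norm_eq_abs, show (volume : Measure (UnitAddTorus (Fin 3))).real univ = 1 from probReal_univ,
    mul_one] at h

/-! ## Along good orbits -/

/-- Along a good orbit (`1 ≤ L`, `0 ≤ τ`): `|∫₀^τ e(1) − ∫₀^τ e(Ξ₁ᴸ)| ≤ C_χ C_{gY}(3/πr³)² (8π/L) τ E(z)/(N+1)`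
(honest time integrals, `integrableOn_enskogRate_flow`; `E(Φ_s z) = E(z)`, `configEnergy_flow`). [folklore] -/
theorem abs_setIntegral_enskogRate_one_sub_le_energy {σ : ℝ} {N : ℕ}
    (Φ : HardSphereFlow (Torus.geometry (Fin 3)) (hsDiameter σ N) (N + 1))
    {z : Config (N + 1) (Fin 3) T3} (hz : z ∈ Φ.good) {χ : ℝ × UnitAddTorus (Fin 3) → ℝ} {g : ℝ → ℝ}
    (hχ : Continuous χ) (hg : Continuous g) {τ Cχ CgY : ℝ} (hτ : 0 ≤ τ)
    (hχb : ∀ s ∈ Icc (0 : ℝ) τ, ∀ x, |χ (s, x)| ≤ Cχ) (hgY : ∀ a, 0 ≤ a → |g a * contactValue a| ≤ CgY)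
    (hσ : 0 ≤ σ) {r L : ℝ} (hr : 0 < r) (hL : 1 ≤ L) :
    |(∫ s in Icc (0 : ℝ) τ, enskogRate σ N χ g (fun _ => (1 : ℝ)) r s (Φ.flow s z)) -
        ∫ s in Icc (0 : ℝ) τ,
          enskogRate σ N χ g (fun q : V3 × V3 × V3 => speedCutoff L ‖q.2.2 - q.2.1‖) r s (Φ.flow s z)|
      ≤ Cχ * CgY * ((3 / (Real.pi * r ^ 3)) ^ 2 * (8 * Real.pi / L)) * τ *
          (configEnergy z / ((N + 1 : ℕ) : ℝ)) := by
  have hL0 : 0 < L := one_pos.trans_le hL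
  have hIP := integrableOn_enskogRate_flow Φ hz hχ hg hχb hgY hσ hr
    (continuous_sphereMark_uncurry continuous_const).measurable abs_sphereMark_one_le'
  have hIL := integrableOn_enskogRate_flow Φ hz hχ hg hχb hgY hσ hr
    (continuous_sphereMark_uncurry (continuous_speedCutoff_mark L)).measurable
    (abs_sphereMark_speedCutoff_le' hL0)
  set K : ℝ := Cχ * CgY * ((3 / (Real.pi * r ^ 3)) ^ 2 * (8 * Real.pi / L)) *
    (configEnergy z / ((N + 1 : ℕ) : ℝ)) with hK
  rw [← integral_sub hIP hIL]
  refine abs_integral_le_integral_abs.trans ?_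
  have hbound : ∀ s ∈ Icc (0 : ℝ) τ,
      |enskogRate σ N χ g (fun _ => (1 : ℝ)) r s (Φ.flow s z) -
        enskogRate σ N χ g (fun q : V3 × V3 × V3 => speedCutoff L ‖q.2.2 - q.2.1‖) r s (Φ.flow s z)| ≤ K :=
    fun s hs => by
      rw [hK, ← Φ.configEnergy_flow hz s]
      exact abs_enskogRate_one_sub_le_energy hχ hg (hχb s hs) hgY hσ hr hL _
  calc ∫ s in Icc (0 : ℝ) τ, |enskogRate σ N χ g (fun _ => (1 : ℝ)) r s (Φ.flow s z) -
          enskogRate σ N χ g (fun q : V3 × V3 × V3 => speedCutoff L ‖q.2.2 - q.2.1‖) r s (Φ.flow s z)|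
      ≤ ∫ s in Icc (0 : ℝ) τ, K :=
        setIntegral_mono_on (hIP.sub hIL).abs
          (integrableOn_const (by rw [Real.volume_Icc]; exact ENNReal.ofReal_ne_top)) measurableSet_Icc
          hbound
    _ = Cχ * CgY * ((3 / (Real.pi * r ^ 3)) ^ 2 * (8 * Real.pi / L)) * τ *
          (configEnergy z / ((N + 1 : ℕ) : ℝ)) := by
        rw [setIntegral_const, Real.volume_real_Icc_of_le hτ, sub_zero, smul_eq_mul, hK]
        ring

/-- One collision term: `(1·|g(σ³ρ_r(xᵢ))|) · m_L(n, vᵢ⁻, vⱼ⁻) ≤ C_g (2/L)(1 + ‖vᵢ‖² + ‖vⱼ‖²)` (`|g| ≤ C_g` on `[0, ∞)`;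
the elastic reflection conserves the pair energy, `norm_sq_reflectVel_fst_add_norm_sq_reflectVel_snd`). [folklore] -/
theorem weightAt_mul_collMark_speedTailMark_le {σ : ℝ} {N : ℕ} {g : ℝ → ℝ} {r L Cg : ℝ} (hσ : 0 ≤ σ)
    (hr : 0 < r) (hL : 0 < L) (hgb : ∀ a, 0 ≤ a → |g a| ≤ Cg) (s : ℝ) (ζ : Config (N + 1) (Fin 3) T3)
    (p : Fin (N + 1) × Fin (N + 1)) :
    weightAt σ N (fun _ => (1 : ℝ)) (fun a => |g a|) r s ζ p.1 * collMark σ N (speedTailMark L) ζ p.1 p.2 ≤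
      Cg * (2 / L) * (1 + ‖(ζ p.1).2‖ ^ 2 + ‖(ζ p.2).2‖ ^ 2) := by
  have hCg0 : 0 ≤ Cg := (abs_nonneg _).trans (hgb 0 le_rfl)
  have hw : |weightAt σ N (fun _ => (1 : ℝ)) (fun a => |g a|) r s ζ p.1| ≤ Cg := by
    unfold weightAt
    have h0 : 0 ≤ σ ^ 3 * mollDensity r ζ (ζ p.1).1 :=
      mul_nonneg (pow_nonneg hσ 3) (mollDensity_nonneg_of_pos hr ζ _)
    rw [one_mul, abs_abs]
    exact hgb _ h0
  have hw' : weightAt σ N (fun _ => (1 : ℝ)) (fun a => |g a|) r s ζ p.1 ≤ Cg := (le_abs_self _).trans hw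
  set vm := reflectVel (sepAt ζ p.1 p.2) ((ζ p.1).2, (ζ p.2).2) with hvm
  have hm : collMark σ N (speedTailMark L) ζ p.1 p.2 ≤ 2 / L * (1 + ‖(ζ p.1).2‖ ^ 2 + ‖(ζ p.2).2‖ ^ 2) := by
    have h1 : collMark σ N (speedTailMark L) ζ p.1 p.2 ≤ ‖vm.2 - vm.1‖ ^ 2 / L :=
      norm_mul_one_sub_speedCutoff_le hL _ _
    have h2 : ‖vm.2 - vm.1‖ ^ 2 ≤ 2 * (‖vm.1‖ ^ 2 + ‖vm.2‖ ^ 2) := norm_sub_sq_le_two_mul vm.1 vm.2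
    have h3 : ‖vm.1‖ ^ 2 + ‖vm.2‖ ^ 2 = ‖(ζ p.1).2‖ ^ 2 + ‖(ζ p.2).2‖ ^ 2 :=
      norm_sq_reflectVel_fst_add_norm_sq_reflectVel_snd _ _
    calc collMark σ N (speedTailMark L) ζ p.1 p.2 ≤ ‖vm.2 - vm.1‖ ^ 2 / L := h1
      _ ≤ 2 * (‖vm.1‖ ^ 2 + ‖vm.2‖ ^ 2) / L := div_le_div_of_nonneg_right h2 hL.le
      _ = 2 / L * (‖(ζ p.1).2‖ ^ 2 + ‖(ζ p.2).2‖ ^ 2) := by rw [h3]; ring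
      _ ≤ 2 / L * (1 + ‖(ζ p.1).2‖ ^ 2 + ‖(ζ p.2).2‖ ^ 2) :=
          mul_le_mul_of_nonneg_left (by linarith) (by positivity)
  have hm0 : 0 ≤ collMark σ N (speedTailMark L) ζ p.1 p.2 := speedTailMark_nonneg L _
  calc weightAt σ N (fun _ => (1 : ℝ)) (fun a => |g a|) r s ζ p.1 * collMark σ N (speedTailMark L) ζ p.1 p.2
      ≤ Cg * (2 / L * (1 + ‖(ζ p.1).2‖ ^ 2 + ‖(ζ p.2).2‖ ^ 2)) := mul_le_mul hw' hm hm0 hCg0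
    _ = Cg * (2 / L) * (1 + ‖(ζ p.1).2‖ ^ 2 + ‖(ζ p.2).2‖ ^ 2) := by ring

/-- **The collision-side tail is dominated by the functional of `CollisionMomentBound`** along a good orbit
(`0 < L`, `0 ≤ σ`, `0 < r`, `|g| ≤ C_g` on `[0, ∞)`): `K_N[1·|g|·m_L] ≤ (2C_g/L) · ε/(N+1) · Σ_{collisions ≤ τ,
ordered contact pairs} (1 + ‖vᵢ‖² + ‖vⱼ‖²)`, the sum reading post-collisional values as the route decl does. [folklore] -/
theorem collisionSum_speedTailMark_le {σ : ℝ} {N : ℕ}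
    {Φ : HardSphereFlow (Torus.geometry (Fin 3)) (hsDiameter σ N) (N + 1)}
    {z : Config (N + 1) (Fin 3) T3} (hz : z ∈ Φ.good) {τ : ℝ} {g : ℝ → ℝ} {r L Cg : ℝ} (hσ : 0 ≤ σ)
    (hr : 0 < r) (hL : 0 < L) (hgb : ∀ a, 0 ≤ a → |g a| ≤ Cg) :
    collisionSum σ N Φ τ (fun _ => 1) (fun a => |g a|) (speedTailMark L) r z ≤
      Cg * (2 / L) * (hsDiameter σ N / (N + 1 : ℝ) *
        collisionPairSum (Torus.geometry (Fin 3)) (hsDiameter σ N) (orbit σ N Φ z) (Icc 0 τ)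
          (fun s i j => 1 + ‖(orbit σ N Φ z s i).2‖ ^ 2 + ‖(orbit σ N Φ z s j).2‖ ^ 2)) := by
  have hfin : (collisionTimes (Torus.geometry (Fin 3)) (hsDiameter σ N) (orbit σ N Φ z) ∩ Icc 0 τ).Finite :=
    (isTraj hz).locFinite 0 τ
  have hε0 : 0 ≤ hsDiameter σ N := by
    unfold hsDiameter; exact mul_nonneg hσ (Real.rpow_nonneg (by positivity) _)
  have hc : 0 ≤ hsDiameter σ N / (N + 1 : ℝ) := by positivity
  rw [collisionSum_eq_collisionPairSum σ N (fun _ => 1) (fun a => |g a|) (speedTailMark L) r Φ τ z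
    (orbit_mem hz)]
  have key := collisionPairSum_mono hfin
    (g := fun s i j => weightAt σ N (fun _ => (1 : ℝ)) (fun a => |g a|) r s (orbit σ N Φ z s) i *
      collMark σ N (speedTailMark L) (orbit σ N Φ z s) i j)
    (g' := fun s i j => Cg * (2 / L) * (1 + ‖(orbit σ N Φ z s i).2‖ ^ 2 + ‖(orbit σ N Φ z s j).2‖ ^ 2))
    fun s _ p _ => weightAt_mul_collMark_speedTailMark_le hσ hr hL hgb s _ p
  refine (mul_le_mul_of_nonneg_left key hc).trans (le_of_eq ?_)
  rw [collisionPairSum_const_mul hfin]; ring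

/-! ## The registered stub -/

/-- **T1 · unit-mark velocity truncation under the EVOLVED local Gibbs law** (registered stub `stub_unitMarkTruncation`
of line `Sketch`, skeleton v17, crux stmt-AtomisticToContinuum-13481, verbatim: `CollisionMomentBound → TruncationUnitLG`).
`η₀` := the band of `exists_bound_mul_contactValue`; `σ₀ := min σ_E σ_M` (`stub_kineticEnergyTight`, `CollisionMomentBound`,
each at `δ/2`); `r₀ := 1` (no smallness of `r`); `L₀ := max 1 (max (4C_χC_gK_b'/η) (2σ³τC_EK'/η))`,
`C_E = C_χ C_{gY}(3/πr³)² 8π`; `N₀ := max`; then the three-set inclusion of the module docstring. [folklore] -/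
theorem stub_unitMarkTruncation :
    CollisionMomentBound →
    ∃ η₀ : ℝ, 0 < η₀ ∧ ∀ (a₀ θ₀ : T3 → ℝ) (u₀ : T3 → V3), Continuous a₀ → Continuous θ₀ → Continuous u₀ →
      (∀ x, 0 < a₀ x) → (∀ x, 0 < θ₀ x) → ∃ σ₀ : ℝ, 0 < σ₀ ∧ ∀ σ : ℝ, 0 < σ → σ < σ₀ →
      ∀ Φ : (N : ℕ) → HardSphereFlow (Torus.geometry (Fin 3)) (hsDiameter σ N) (N + 1),
      ∀ τ : ℝ, 0 < τ → ∀ χ : ℝ × T3 → ℝ, Continuous χ → ∀ g : ℝ → ℝ, Continuous g →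
      (∀ x, η₀ ≤ x → g x = 0) →
      ∀ η δ : ℝ, 0 < η → 0 < δ → ∃ r₀ : ℝ, 0 < r₀ ∧ ∀ r : ℝ, 0 < r → r < r₀ →
      ∃ L₀ : ℝ, ∀ L : ℝ, L₀ ≤ L → ∃ N₀ : ℕ, ∀ N : ℕ, N₀ ≤ N →
        localGibbsLaw σ a₀ u₀ θ₀ N (Φ N)
          {z | η < |evenStat σ N (Φ N) τ χ g (fun _ => 1) r z -
              evenStat σ N (Φ N) τ χ g (fun q : V3 × V3 × V3 => speedCutoff L ‖q.2.2 - q.2.1‖) r z|}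
          ≤ ENNReal.ofReal δ := by
  intro hCMB
  obtain ⟨ηY, hηY, hY⟩ := exists_bound_mul_contactValue hsEosLowDensity_JParityClosure
  refine ⟨ηY, hηY, fun a₀ θ₀ u₀ ha hθ hu ha0 hθ0 => ?_⟩
  obtain ⟨σE, hσE, HE⟩ := stub_kineticEnergyTight a₀ θ₀ u₀ ha hθ hu ha0 hθ0
  obtain ⟨σM, hσM, HM⟩ := hCMB a₀ θ₀ u₀ ha hθ hu ha0 hθ0
  refine ⟨min σE σM, lt_min hσE hσM, ?_⟩
  intro σ hσ hσlt Φ τ hτ χ hχ g hg hg0 η δ hη hδ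
  have hσE' : σ < σE := lt_of_lt_of_le hσlt (min_le_left _ _)
  have hσM' : σ < σM := lt_of_lt_of_le hσlt (min_le_right _ _)
  obtain ⟨Cχ', -, hχb'⟩ := exists_abs_bound_chi hχ τ
  set Cχ := max Cχ' 1 with hCχdef
  have hχb : ∀ s ∈ Icc (0 : ℝ) τ, ∀ x, |χ (s, x)| ≤ Cχ := fun s hs x => (hχb' s hs x).trans (le_max_left _ _)
  have hCχ0 : 0 < Cχ := one_pos.trans_le (le_max_right _ _)
  obtain ⟨CgY, hCgY0, hgY⟩ := hY g hg hg0
  obtain ⟨Cg', -, hCg'⟩ := exists_abs_bound_of_cutoff hg hg0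
  set Cg := max Cg' 1 with hCgdef
  have hgb : ∀ a, 0 ≤ a → |g a| ≤ Cg := fun a ha => (hCg' a ha).trans (le_max_left _ _)
  have hCg0 : 0 < Cg := one_pos.trans_le (le_max_right _ _)
  obtain ⟨K, NE, hKev⟩ := HE σ hσ hσE' Φ (δ / 2) (half_pos hδ)
  obtain ⟨Kb, NM, hMev⟩ := HM σ hσ hσM' Φ τ hτ (δ / 2) (half_pos hδ)
  obtain ⟨K', hKK', hK'0⟩ : ∃ K' : ℝ, K ≤ K' ∧ 0 ≤ K' := ⟨max K 0, le_max_left _ _, le_max_right _ _⟩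
  obtain ⟨Kb', hKbKb', hKb'0⟩ : ∃ Kb' : ℝ, Kb ≤ Kb' ∧ 0 ≤ Kb' := ⟨max Kb 0, le_max_left _ _, le_max_right _ _⟩
  refine ⟨1, one_pos, fun r hr _ => ?_⟩
  set CE : ℝ := Cχ * CgY * ((3 / (Real.pi * r ^ 3)) ^ 2 * (8 * Real.pi)) with hCEdef
  have hCE0 : 0 ≤ CE := by positivity
  refine ⟨max 1 (max (4 * Cχ * Cg * Kb' / η) (2 * σ ^ 3 * τ * CE * K' / η)), fun L hL => ?_⟩
  have hL1 : 1 ≤ L := (le_max_left _ _).trans hL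
  have hL0 : 0 < L := one_pos.trans_le hL1
  have hLK : 4 * Cχ * Cg * Kb' / η ≤ L := ((le_max_left _ _).trans (le_max_right _ _)).trans hL
  have hLE : 2 * σ ^ 3 * τ * CE * K' / η ≤ L := ((le_max_right _ _).trans (le_max_right _ _)).trans hL
  refine ⟨max NE NM, fun N hN => ?_⟩
  have hn : (0 : ℝ) < ((N + 1 : ℕ) : ℝ) := by exact_mod_cast Nat.succ_pos N
  have hK1 := hKev N ((le_max_left _ _).trans hN) 0
  have hM1 := hMev N ((le_max_right _ _).trans hN)
  simp only [] at hM1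
  set P := localGibbsLaw σ a₀ u₀ θ₀ N (Φ N) with hP
  obtain ⟨EK, hEK⟩ : ∃ EK : Set (Config (N + 1) (Fin 3) T3),
      EK = {z | K < ((N : ℝ) + 1)⁻¹ * configEnergy ((Φ N).flow 0 z)} := ⟨_, rfl⟩
  obtain ⟨EM, hEM⟩ : ∃ EM : Set (Config (N + 1) (Fin 3) T3), EM = {z | Kb < hsDiameter σ N / (N + 1 : ℝ) *
    ∑ᶠ (s : ℝ) (_ : s ∈ collisionTimes (Torus.geometry (Fin 3)) (hsDiameter σ N) (fun s => (Φ N).flow s z) ∩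
      Set.Icc 0 τ), ∑ i : Fin (N + 1), ∑ j : Fin (N + 1),
        (if i ≠ j ∧ ‖(Torus.geometry (Fin 3)).sepVec ((Φ N).flow s z i).1 ((Φ N).flow s z j).1‖ =
          hsDiameter σ N then 1 + ‖((Φ N).flow s z i).2‖ ^ 2 + ‖((Φ N).flow s z j).2‖ ^ 2 else 0)} :=
    ⟨_, rfl⟩
  have hPK : P EK ≤ ENNReal.ofReal (δ / 2) := by rw [hEK]; exact hK1
  have hPM : P EM ≤ ENNReal.ofReal (δ / 2) := by rw [hEM]; exact hM1
  have hP0 : P (Φ N).goodᶜ = 0 := localGibbsLaw_compl_good_eq_zero (Φ N)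
  have hsub : {z | η < |evenStat σ N (Φ N) τ χ g (fun _ => 1) r z -
      evenStat σ N (Φ N) τ χ g (fun q : V3 × V3 × V3 => speedCutoff L ‖q.2.2 - q.2.1‖) r z|} ⊆
      ((Φ N).goodᶜ ∪ EK) ∪ EM := by
    intro z hz
    by_contra hnot
    simp only [mem_union, not_or] at hnot
    obtain ⟨⟨hgood, hzK⟩, hzM⟩ := hnot
    have hzg : z ∈ (Φ N).good := not_notMem.1 hgood
    rw [hEK] at hzK; rw [hEM] at hzM
    simp only [mem_setOf_eq, not_lt] at hzK hzM hz
    have hEz : configEnergy z / ((N + 1 : ℕ) : ℝ) ≤ K' := by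
      rw [(Φ N).flow_zero z hzg] at hzK; rw [div_le_iff₀ hn]
      calc configEnergy z = ((N : ℝ) + 1) * (((N : ℝ) + 1)⁻¹ * configEnergy z) := by field_simp
        _ ≤ ((N : ℝ) + 1) * K := mul_le_mul_of_nonneg_left hzK (by positivity)
        _ ≤ ((N : ℝ) + 1) * K' := mul_le_mul_of_nonneg_left hKK' (by positivity)
        _ = K' * ((N + 1 : ℕ) : ℝ) := by push_cast; ring
    have hCPS : hsDiameter σ N / (N + 1 : ℝ) *
        collisionPairSum (Torus.geometry (Fin 3)) (hsDiameter σ N) (orbit σ N (Φ N) z) (Icc 0 τ)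
          (fun s i j => 1 + ‖(orbit σ N (Φ N) z s i).2‖ ^ 2 + ‖(orbit σ N (Φ N) z s j).2‖ ^ 2) ≤ Kb' := by
      rw [collisionPairSum_eq_finsum_ite (orbit_mem hzg)]; exact hzM.trans hKbKb'
    have hcoll := abs_collisionSum_one_sub_le (Φ N) g r hσ hL1 hχb
      (((Φ N).isTrajectory z hzg).locFinite 0 τ)
    have hcoll' := collisionSum_speedTailMark_le (τ := τ) hzg hσ.le hr hL0 hgb
    have hensk := abs_setIntegral_enskogRate_one_sub_le_energy (Φ N) hzg hχ hg hτ.le hχb hgY hσ.le hr hL1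
    have hσ3 : 0 ≤ σ ^ 3 := by positivity
    have hA : |collisionSum σ N (Φ N) τ χ g (fun _ => (1 : ℝ)) r z
        - collisionSum σ N (Φ N) τ χ g (fun q : V3 × V3 × V3 => speedCutoff L ‖q.2.2 - q.2.1‖) r z|
        ≤ η / 2 := by
      refine hcoll.trans ?_
      have h1 : Cχ * collisionSum σ N (Φ N) τ (fun _ => 1) (fun a => |g a|) (speedTailMark L) r z ≤
          Cχ * (Cg * (2 / L) * Kb') :=
        mul_le_mul_of_nonneg_left (hcoll'.trans (mul_le_mul_of_nonneg_left hCPS (by positivity))) hCχ0.le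
      refine h1.trans ?_
      rw [div_le_iff₀ hη] at hLK
      have h2 : Cχ * (Cg * (2 / L) * Kb') = (2 * Cχ * Cg * Kb') / L := by field_simp
      rw [h2, div_le_iff₀ hL0]
      nlinarith
    have hB : σ ^ 3 * |(∫ s in Icc (0 : ℝ) τ, enskogRate σ N χ g (fun _ => (1 : ℝ)) r s ((Φ N).flow s z)) -
        ∫ s in Icc (0 : ℝ) τ, enskogRate σ N χ g (fun q : V3 × V3 × V3 => speedCutoff L ‖q.2.2 - q.2.1‖) r s
          ((Φ N).flow s z)| ≤ η / 2 := by
      refine (mul_le_mul_of_nonneg_left hensk hσ3).trans ?_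
      have h2 : σ ^ 3 * (Cχ * CgY * ((3 / (Real.pi * r ^ 3)) ^ 2 * (8 * Real.pi / L)) * τ *
          (configEnergy z / ((N + 1 : ℕ) : ℝ))) = (σ ^ 3 * τ * CE / L) * (configEnergy z / ((N + 1 : ℕ) : ℝ)) := by
        rw [hCEdef]; field_simp
      rw [h2]
      refine (mul_le_mul_of_nonneg_left hEz (by positivity : 0 ≤ σ ^ 3 * τ * CE / L)).trans ?_
      rw [div_le_iff₀ hη] at hLE
      rw [div_mul_eq_mul_div, div_le_iff₀ hL0]
      nlinarith
    simp only [evenStat_def] at hz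
    rw [show ∀ a b c d : ℝ, a - σ ^ 3 * b - (c - σ ^ 3 * d) = (a - c) - σ ^ 3 * (b - d) from
      fun a b c d => by ring] at hz
    have h3 := (lt_of_lt_of_le hz (abs_sub _ _)).trans_le
      (add_le_add hA (le_of_eq_of_le (by rw [abs_mul, abs_of_nonneg hσ3]) hB))
    linarith
  calc P {z | η < |evenStat σ N (Φ N) τ χ g (fun _ => 1) r z -
          evenStat σ N (Φ N) τ χ g (fun q : V3 × V3 × V3 => speedCutoff L ‖q.2.2 - q.2.1‖) r z|}
      ≤ P (((Φ N).goodᶜ ∪ EK) ∪ EM) := measure_mono hsub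
    _ ≤ P ((Φ N).goodᶜ ∪ EK) + P EM := measure_union_le _ _
    _ ≤ (P (Φ N).goodᶜ + P EK) + P EM := add_le_add (measure_union_le _ _) le_rfl
    _ ≤ (0 + ENNReal.ofReal (δ / 2)) + ENNReal.ofReal (δ / 2) :=
        add_le_add (add_le_add hP0.le hPK) hPM
    _ = ENNReal.ofReal δ := by
        rw [zero_add, ← ENNReal.ofReal_add (by positivity) (by positivity), add_halves]

end Summit.AtomisticToContinuum.HydrodynamicLimit.Theorems.CollisionRate

end
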